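import Summits.Schanuel.Schanuel.Theorems.RootDecomp1KNW96Core06

/-!
# RootDecomp1KNW96Core — lens 6, generation 23 «NW96 THEOREM 1, c = 400, HYPOTHESIS-FREE» (PROGRAMME G23-b; VERDICT L2175: THEOREM ×1): `theorem nw1996MainR_400 : NW1996MainR 400` — Nesterenko–Waldschmidt 1996 Theorem 1 (first assertion) with the absolute constant 400 in place of the printed 211, SORRY-FREE, NO hypothesis, NO named fact; = `core` (parts 01–03) + the glue `mainR_of_paramsOK : ParamsOK c → NW1996MainR c` + the audited repair parameters `paramsOK_400` (S = ⌊25UV⌋, S₁ = ⌊9DW+½⌋, T = ⌊33DVW⌋, T₁ = ⌊5U+½⌋, H = ⌊1.1 W log E⌋, ε = E^{−400DUVW}) — continuation (RootDecomp1KNW96Core07): §5 ParamsE (paramsOK_400) + §6 nw1996MainR_400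

(lens-6 g23 HOME kernel g23b/NW96Main.lean 5c2fab87…, 2022 l = NW96Core.lean body byte-identical (ported as parts 01–03) + §4–§6; extra imports Literature PiTranscendenceMeasureMain + PiTranscendenceMeasureParams + ExpLogSimultaneousApproximationMeasure (the def `NW1996MainR`, census p828340); NODE L2171 / REQUEST L2172 / ADDENDUM L2174, writer re-check L2173, critic VERDICT L2175 (CLEARED — THEOREM ×1 (G23-b); lens-6 tally THEOREM ×6 + CELL ×3 + AUDIT ×1; RULE G24; PORT GO priority HIGH, Summit-side first; Literature relocation of `nw1996MainR_400` next to the cite-tagged fact = later census pass); port by census-1 gen 18 as `RootDecomp1KNW96Core04`–`07`: 04 = §4 the glue `ParamsOK`, `mainR_of_paramsOK` + §5 ParamsA; 05 = §5 ParamsB + ParamsC; 06 = §5 ParamsD; 07 = §5 ParamsE (`paramsOK_400`, scoped `maxHeartbeats 1000000` as in K) + §6 the headline `nw1996MainR_400`.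
PORT EDITS: `set_option linter.dupNamespace false` and `import HarnessLib` dropped; parts 01–03 untouched; statements and proofs verbatim. `--supports stmt-Schanuel-33364`; no census credit carried; rung 0 — nothing here proves Schanuel. CONSEQUENCE OF RECORD: the registered fact `NesterenkoWaldschmidt1996_thm_1` (constant 211, PRINT-CLAIM · PROOF-GAP per the g22 audit) now has a PROVED weaker-constant companion in the tree; RULE G24 (critic L2175) governs the consumer re-typing generic in c.)
-/

noncomputable section

open Finset

namespace Summit.Schanuel.Schanuel.Theorems.RootDecomp1KNW96Core

open Literature.NumberTheory.Transcendental

section Params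

open Real

section ParamsE

/-! ### E. `expo`, `ParamsOK` (verbatim as in `NW96CoreMain.lean` §4) and the theorem `ParamsOK 400` -/

set_option maxHeartbeats 1000000 in
/-- **`ParamsOK 400`** — the parameters of the audited repair scheme satisfy every hypothesis of
`core` with `ε = E^{−400 DUVW}`: `S = ⌊25UV⌋`, `S₁ = ⌊9DW + ½⌋`, `T = ⌊33DVW⌋`, `T₁ = ⌊5U + ½⌋`,
`H = ⌊1.1 W log E⌋`, `R = max(1,|θ|) + 1`, `B = e^{|θ|}(1 + 1/(2T₁S₁+2))`, `M = log` of the analytic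
majorant.  Budget `161.2 DUVW log E + log 2 < (L−1)/2 · log E`, `L > 330 DUVW`.
[cite: NesterenkoWaldschmidt1996, Theorem 1, §6; REPAIR-v2 §3′–§4 (decomp-schanuel lens 6)] -/
theorem paramsOK_400 : ParamsOK 400 := by
  intro Dn lA lB E r hDn hlA hlB hE hr
  obtain ⟨ℓ, hℓ⟩ : ∃ ℓ : ℝ, ℓ = Real.log E := ⟨_, rfl⟩
  obtain ⟨u, hu⟩ : ∃ u : ℝ, u = 33 / 10 * (Dn : ℝ) * Real.log ((Dn : ℝ) + 2) + ℓ := ⟨_, rfl⟩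
  obtain ⟨v, hv⟩ : ∃ v : ℝ, v = (Dn : ℝ) * lA + 2 * E * r + 6 * ℓ := ⟨_, rfl⟩
  obtain ⟨w, hw⟩ : ∃ w : ℝ,
      w = lB + Real.log lA + 4 * Real.log (Dn : ℝ) + 2 * Real.log (E * max 1 r) + 10 := ⟨_, rfl⟩
  obtain ⟨hℓ1, hE1, ⟨hlA0, hDlA, -⟩, hu1, ⟨hv1, hv2⟩, hw1, hlogEr, hlogrp⟩ :=
    data_bounds Dn hDn hlA hlB hE hr hℓ hu hv hw
  have hD1 : (1 : ℝ) ≤ (Dn : ℝ) := by exact_mod_cast hDn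
  have hℓ0 : 0 < ℓ := by linarith only [hℓ1]
  obtain ⟨U, hU⟩ : ∃ U : ℝ, U = u / ℓ := ⟨_, rfl⟩
  obtain ⟨V, hV⟩ : ∃ V : ℝ, V = v / ℓ := ⟨_, rfl⟩
  obtain ⟨W, hW⟩ : ∃ W : ℝ, W = w / ℓ := ⟨_, rfl⟩
  obtain ⟨hU1, hV6, hW2, hWℓ, -, hUu, hVv, hWw, hP12⟩ := UVW_bounds hD1 hℓ1 hu1 hv1 hw1 hU hV hW
  obtain ⟨hUup, hVup⟩ := UV_upper hD1 hℓ1 hDlA hE1 hr hu hv hU hV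
  -- the parameters
  obtain ⟨T₁, hT₁⟩ : ∃ T₁ : ℕ, T₁ = ⌊5 * U + 1 / 2⌋₊ := ⟨_, rfl⟩
  obtain ⟨S₁, hS₁⟩ : ∃ S₁ : ℕ, S₁ = ⌊9 * (Dn : ℝ) * W + 1 / 2⌋₊ := ⟨_, rfl⟩
  obtain ⟨H, hH⟩ : ∃ H : ℕ, H = ⌊11 / 10 * (W * ℓ)⌋₊ := ⟨_, rfl⟩
  obtain ⟨S, hS⟩ : ∃ S : ℕ, S = ⌊25 * U * V⌋₊ := ⟨_, rfl⟩
  obtain ⟨T, hT⟩ : ∃ T : ℕ, T = ⌊33 * (Dn : ℝ) * V * W⌋₊ := ⟨_, rfl⟩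
  obtain ⟨⟨hT₁le, -⟩, ⟨hS₁le, -⟩, ⟨hHle, hHgt⟩, ⟨hSle, -⟩, ⟨hTle, -⟩⟩ :=
    params_floors hD1 hU1 hV6 hW2 hℓ1 hT₁ hS₁ hH hS hT
  obtain ⟨⟨hH1, hT₁1, hS₁1, hS1⟩, h2T₁, hcount⟩ := params_counts hD1 hU1 hV6 hW2 hℓ1 hT₁ hS₁ hH hS hT
  obtain ⟨L, hL⟩ : ∃ L : ℕ, L = (T + 1) * (2 * T₁ + 1) := ⟨_, rfl⟩
  obtain ⟨m, hm⟩ : ∃ m : ℕ, m = S₁ * (T + 1) * (T₁ * (T₁ + 1)) := ⟨_, rfl⟩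
  obtain ⟨hLlow, hLhigh, h2m, hNP, hSP⟩ := params_L hD1 hU1 hV6 hW2 hℓ1 hT₁ hS₁ hH hS hT hL hm
  -- `Ψ = DUVW ≥ 12` and the exponent `X = 400 Ψ log E`
  have hP : 12 ≤ (Dn : ℝ) * U * V * W := le_trans (by linarith only [hD1]) hP12
  have hX : expo 400 Dn lA lB E r = 400 * ((Dn : ℝ) * U * V * W) * ℓ := by
    rw [hU, hV, hW, hu, hv, hw, hℓ]
    unfold expo
    have hl : Real.log E ≠ 0 := by rw [← hℓ]; exact hℓ0.ne'
    field_simp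
  -- the error and the radii
  have hU0 : 0 ≤ U := by linarith only [hU1]
  have hV0 : 0 < V := by linarith only [hV6]
  have hD0 : (0 : ℝ) ≤ (Dn : ℝ) := Nat.cast_nonneg _
  have hVr : 2 * E * r ≤ V * ℓ := by rw [hVv]; exact hv2
  have hVP : 2 * V ≤ (Dn : ℝ) * U * V * W := by
    have hDU : 1 * 1 ≤ (Dn : ℝ) * U := mul_le_mul hD1 hU1 (by norm_num) hD0
    have h1 : 1 * 1 * V ≤ ((Dn : ℝ) * U) * V := mul_le_mul_of_nonneg_right hDU hV0.le
    have h2 : ((Dn : ℝ) * U * V) * 2 ≤ ((Dn : ℝ) * U * V) * W :=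
      mul_le_mul_of_nonneg_left hW2 (mul_nonneg (mul_nonneg hD0 hU0) hV0.le)
    linarith only [h1, h2]
  have hN1 : (1 : ℝ) ≤ ((T₁ * S₁ : ℕ) : ℝ) := by
    have : 1 ≤ T₁ * S₁ := Nat.mul_le_mul hT₁1 hS₁1
    exact_mod_cast this
  obtain ⟨-, hε1, hε2, hc4, hc5, hB0, hlogB0, hlogB⟩ :=
    eps_facts hP hℓ1 hX.ge hr hE1 hVr hVP hN1 hNP
  have hR1 : (1 : ℝ) ≤ max 1 r + 1 := by linarith only [le_max_left (1 : ℝ) r]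
  have hE0 : (0 : ℝ) < E := by linarith only [hE1]
  have hE1' : (1 : ℝ) ≤ E := by linarith only [hE1]
  have hR0 : (0 : ℝ) < max 1 r + 1 := by linarith only [hR1]
  have hDlA0 : (0 : ℝ) ≤ (Dn : ℝ) * lA := by linarith only [hDlA]
  -- the witnesses
  refine ⟨H, T, T₁, S, S₁, L, m, max 1 r + 1, Real.exp r * (1 + 1 / (2 * ((T₁ * S₁ : ℕ) : ℝ) + 2)),
    (S : ℝ) * Real.log S + ((T : ℝ) + H) + T * Real.log (1 + E * S₁ / H) +
      S * Real.log ((max 1 r + 1) * T₁) + r * T₁ * (E * S₁),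
    hL, hm, hH1, hT₁1, h2T₁, hcount, by linarith only [hε1], hc4, hε2, hc5, ?_, ?_, ?_⟩
  · -- the analytic majorant `hMf` (equality)
    exact le_of_eq (bigM_eq hS1 hT₁1 hH1 hE0 hR0)
  · -- the perturbation majorant `hMp`
    exact params_small hS1 hT₁1 hS₁1 hH1 hE1 hℓ hℓ1 hP hX.ge hr hR1 hB0 hlogB hSP hNP hLhigh
  · -- the main inequality: the four groups, the row inequality, times `L`
    obtain ⟨hH0, -, hlb0, hlb⟩ :=
      lb_le (S₁ := (S₁ : ℝ)) (H := (H : ℝ)) hD1 hW2 hℓ1 hWℓ hHgt (Nat.cast_nonneg _) hS₁le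
    have hlbE := lbE_le (S₁ := (S₁ : ℝ)) (H := (H : ℝ)) hE1' hH0 (Nat.cast_nonneg _)
    rw [← hℓ] at hlbE
    have hTs := Tside Dn hDn
    obtain ⟨hlogU, hl3, hl3'⟩ := logU_le hD1 hU1 hUup
    have hlogV := logV_le hD1 hV0 hVup hDlA hlA0 hE1 hℓ
    have hw' : W * ℓ = lB + Real.log lA + 4 * Real.log (Dn : ℝ) + 2 * (ℓ + Real.log (max 1 r)) + 10 := by
      rw [hWw, hw, hlogEr]
    have hS1r : (1 : ℝ) ≤ S := by exact_mod_cast hS1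
    have hT₁1r : (1 : ℝ) ≤ T₁ := by exact_mod_cast hT₁1
    have hside := side3 (R := max 1 r + 1) hD1 hU1 hlogU hl3 hl3' hV6 hlogV hℓ1 hS1r hSle hT₁1r hT₁le rfl
    have hL0 : (0 : ℝ) < L := by linarith only [hLlow, hP]
    have hlogL := logL_le hD1 hU1 hlogU hl3 hl3' hV6 hlogV hW2 hℓ1 hlB hw' hL0 hLhigh
    have hlogB1 : Real.log (Real.exp r * (1 + 1 / (2 * ((T₁ * S₁ : ℕ) : ℝ) + 2))) ≤ r + 1 := by
      have : 1 / (2 * ((T₁ * S₁ : ℕ) : ℝ) + 2) ≤ 1 := by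
        rw [div_le_iff₀ (by positivity)]; linarith only [hN1]
      linarith only [hlogB, this]
    have hG1 := group1 hD1 hU1 hW2 hℓ1 hDlA0 hE1 hr (Nat.cast_nonneg S₁)
      hS₁le (Nat.cast_nonneg T₁) hT₁le hlogB0 hlogB1 (by rw [hVv, hv])
    have hG2 := group2 (T := (T : ℝ)) hD1 hV6 hW2 hℓ1 hu hUu hTs hlb0 hlb hlbE (Nat.cast_nonneg T) hTle
    have hG3 := group3 hD1 hU1 hV6 hW2 hℓ1 hS1r hSle hT₁1r hR1 hlB hw' hside
    have hG4 := group4 (L := (L : ℝ)) hD1 hU1 hV6 hW2 hℓ1 (Nat.cast_nonneg S) hSle (Nat.cast_nonneg H)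
      hHle hlogL
    have hrow := row_lt hP hℓ1 hLlow hG1 hG2 hG3 hG4
    have hmul := mul_lt_mul_of_pos_left hrow hL0
    have ha := mul_le_mul_of_nonneg_right h2m hDlA0
    have hb : (m : ℝ) * Real.log (Real.exp r * (1 + 1 / (2 * ((T₁ * S₁ : ℕ) : ℝ) + 2))) ≤
        (L : ℝ) * ((S₁ : ℝ) * ((T₁ : ℝ) + 1 / 2)) / 2 *
          Real.log (Real.exp r * (1 + 1 / (2 * ((T₁ * S₁ : ℕ) : ℝ) + 2))) :=
      mul_le_mul_of_nonneg_right (by linarith only [h2m]) hlogB0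
    rw [← hℓ]
    linarith only [hmul, ha, hb]

end ParamsE

end Params

/-! ## §6. NW96 Theorem 1 with the absolute constant `400` — hypothesis-free (PROGRAMME G23-b (b1)) -/

/-- **Nesterenko–Waldschmidt 1996, Theorem 1, with the absolute constant `400`** — hypothesis-free and
sorry-free: `core` (§3) + `mainR_of_paramsOK` (§4) + `paramsOK_400` (§5).  The printed constant is `211`,
whose printed parameter box fails (REPAIR-v2 §1, decomp-schanuel lens 6); `400` is the audited repair
(REPAIR-v2 §3′/§4): `S = ⌊25UV⌋`, `S₁ = ⌊9DW + ½⌋`, `T = ⌊33DVW⌋`, `T₁ = ⌊5U + ½⌋`, `H = ⌊1.1 W log E⌋`.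
[cite: NesterenkoWaldschmidt1996, Theorem 1 (Mat. Zapiski 2 (1996) 23–42; arXiv:math/0002047)] -/
theorem nw1996MainR_400 : NW1996MainR 400 := mainR_of_paramsOK paramsOK_400

end Summit.Schanuel.Schanuel.Theorems.RootDecomp1KNW96Core

end
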